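import Summits.CriticalPhenomena.PercolationContinuityZ3.Theorems.PercNearOneGluingNoHeavyLowerTailTwoPortExchange
import Summits.CriticalPhenomena.PercolationContinuityZ3.Theorems.PercNearOneGluingNoHeavyLowerTailCILGlueLeadPersistence
import HarnessLib

/-!
# `NoHeavyLowerTail` (stmt-CriticalPhenomena-4575) — deleting the observer–`q` pair preserves the restricted-attachment
# exchange, and REX(2) for observers adjacent only to `a`, `b` and `q`

Support file (lemma factory #8 `prim-lf-8`, gen 11; `--supports stmt-CriticalPhenomena-4575`).  No definitions, no named
facts, no sorries.  `μ_w = prodBernoulli w` on `Fin n`, relays `A`, level `j`, `π(v) = {a ∈ A : v ↔ a}`, `L_v = {|π(v)| ≤ j}`,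
`H_v = {|π(v)| > j}`; for an event `E` ("the observer is attached"), `F_E(w) = μ_w(E ∩ L_o ∩ H_q) − μ_w(E ∩ H_o ∩ L_q)`.

* `ObserverPairDeletion.exchange_eq_deleted` — both exchange events force `o ↮ q`, hence the pair `e = s(o,q)` closed, so
  `μ_w(E ∩ L_o ∩ H_q) = (1 − w e) · μ_{w[e↦0]}(E ∩ L_o ∩ H_q)` (and likewise for the heavy side): one-bond decomposition
  (`stub_oneBondDecomp_k15`) and the observation that under `w[e↦1]` the pair is almost surely open.
* `ObserverPairDeletion.rex_of_deleted` — **WLOG the observer is not adjacent to `q`**: if `q` beats `x` in `w` then it still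
  beats `x` after the pair `s(o,q)` is deleted (pair-deletion persistence `ExchangeTools.forwardGreedy_step`, prim-lf-3), so REX
  for `(w[s(o,q)↦0], o)` (with its own beating hypothesis) implies REX for `(w, o)`.
* `ObserverPairDeletion.threePort_rex` — REX(`Q = {a,b}`; `q`) for every observer `o ∉ A` whose positive-weight pairs go only
  to `a`, `b` and `q`: delete `s(o,q)` and apply the two-port theorem `TwoPortExchange.twoPort_rex` (prim-lf-8 gen 9) in the
  deleted weights.  (Seat census: REX 0 violations for all observers; this is the first three-neighbour family in Lean.)
-/

noncomputable section

namespace Summit.CriticalPhenomena.PercolationContinuityZ3.Theorems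

open MeasureTheory Set Literature.Probability.LatticeModels Literature.Probability.Percolation
open scoped Classical BigOperators

variable {n : ℕ}

namespace ObserverPairDeletion

/-- Under `w[s(o,q) ↦ 1]` an event on which `o` and `q` have different lightness is null (the pair is a.s. open, so
`o ↔ q` and `π(o) = π(q)`). [folklore] -/
theorem real_glued_mismatch_eq_zero (w : Sym2 (Fin n) → unitInterval) (A : Finset (Fin n)) (o q : Fin n)
    (hqo : q ≠ o) (E : Set (BondConfig (Fin n))) (P Pq : ℕ → Prop) (hP : ∀ c, ¬ (P c ∧ Pq c)) :
    (prodBernoulli (Function.update w s(o, q) 1)).real (E ∩ {ω | P (A.filter fun r => ω ∈ openConn o r).card} ∩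
        {ω | Pq (A.filter fun r => ω ∈ openConn q r).card}) = 0 := by
  set w₁ := Function.update w s(o, q) 1 with hw₁
  have hnull : (prodBernoulli w₁).real {ω : BondConfig (Fin n) | s(o, q) ∉ ω} = 0 := by
    rw [prodBernoulli_real_setOf_notMem, hw₁, Function.update_self]; simp
  have hsub : (E ∩ {ω | P (A.filter fun r => ω ∈ openConn o r).card} ∩
      {ω | Pq (A.filter fun r => ω ∈ openConn q r).card}) ⊆ {ω : BondConfig (Fin n) | s(o, q) ∉ ω} := by
    rintro ω ⟨⟨-, hPo⟩, hPq⟩ hmem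
    have hreach : ω ∈ (openConn o q : Set (BondConfig (Fin n))) := by
      show (openGraph ω).Reachable o q
      exact SimpleGraph.Adj.reachable ((openGraph_adj ω o q).2 ⟨hmem, hqo.symm⟩)
    have heq := ConditionedChampionExchange.filter_eq_of_openConn A hreach
    simp only [mem_setOf_eq] at hPo hPq
    rw [heq] at hPo
    exact hP _ ⟨hPo, hPq⟩
  exact le_antisymm (le_trans (measureReal_mono hsub (measure_ne_top _ _)) hnull.le) measureReal_nonneg

/-- **The exchange masses live off the observer–`q` pair**: for every event `E`,
`μ_w(E ∩ L_o ∩ H_q) = (1 − w s(o,q)) · μ_{w[s(o,q)↦0]}(E ∩ L_o ∩ H_q)`, and the same for `E ∩ H_o ∩ L_q`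
(stated for arbitrary incompatible lightness predicates `P`, `Pq`). [this work] -/
theorem exchange_eq_deleted (w : Sym2 (Fin n) → unitInterval) (A : Finset (Fin n)) (o q : Fin n)
    (hqo : q ≠ o) (E : Set (BondConfig (Fin n))) (P Pq : ℕ → Prop) (hP : ∀ c, ¬ (P c ∧ Pq c)) :
    (prodBernoulli w).real (E ∩ {ω | P (A.filter fun r => ω ∈ openConn o r).card} ∩
        {ω | Pq (A.filter fun r => ω ∈ openConn q r).card}) =
      (1 - (w s(o, q) : ℝ)) * (prodBernoulli (Function.update w s(o, q) 0)).real
        (E ∩ {ω | P (A.filter fun r => ω ∈ openConn o r).card} ∩ {ω | Pq (A.filter fun r => ω ∈ openConn q r).card}) := by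
  rw [stub_oneBondDecomp_k15 n w s(o, q), real_glued_mismatch_eq_zero w A o q hqo E P Pq hP, mul_zero, add_zero]

/-- **WLOG the observer is not adjacent to `q`.**  Let `e = s(o,q)` and `w₀ = w[e ↦ 0]`.  If REX holds for the observer `o`
in `w₀` — i.e. beating of `Q` by `q` in `w₀` implies `μ_{w₀}(E ∩ L_o ∩ H_q) ≤ μ_{w₀}(E ∩ H_o ∩ L_q)` — then beating in `w`
implies the same inequality in `w`: beating survives the deletion of a pair at the winner (`ExchangeTools.forwardGreedy_step`)
and both masses are `(1 − w e)` times their `w₀`-values (`exchange_eq_deleted`). [this work] -/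
theorem rex_of_deleted (w : Sym2 (Fin n) → unitInterval) (A Q : Finset (Fin n)) (o q : Fin n) (j : ℕ) (hqo : q ≠ o)
    (E : Set (BondConfig (Fin n)))
    (hREX₀ : (∀ x ∈ Q, (prodBernoulli (Function.update w s(o, q) 0)).real
          {ω : BondConfig (Fin n) | (A.filter fun r => ω ∈ openConn x r).card ≤ j} ≤
        (prodBernoulli (Function.update w s(o, q) 0)).real
          {ω : BondConfig (Fin n) | (A.filter fun r => ω ∈ openConn q r).card ≤ j}) →
      (prodBernoulli (Function.update w s(o, q) 0)).real (E ∩ {ω | (A.filter fun r => ω ∈ openConn o r).card ≤ j} ∩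
          {ω | j < (A.filter fun r => ω ∈ openConn q r).card}) ≤
        (prodBernoulli (Function.update w s(o, q) 0)).real (E ∩ {ω | j < (A.filter fun r => ω ∈ openConn o r).card} ∩
          {ω | (A.filter fun r => ω ∈ openConn q r).card ≤ j}))
    (hbeat : ∀ x ∈ Q, (prodBernoulli w).real {ω : BondConfig (Fin n) | (A.filter fun r => ω ∈ openConn x r).card ≤ j} ≤
      (prodBernoulli w).real {ω : BondConfig (Fin n) | (A.filter fun r => ω ∈ openConn q r).card ≤ j}) :
    (prodBernoulli w).real (E ∩ {ω | (A.filter fun r => ω ∈ openConn o r).card ≤ j} ∩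
        {ω | j < (A.filter fun r => ω ∈ openConn q r).card}) ≤
      (prodBernoulli w).real (E ∩ {ω | j < (A.filter fun r => ω ∈ openConn o r).card} ∩
        {ω | (A.filter fun r => ω ∈ openConn q r).card ≤ j}) := by
  have hP1 : ∀ c : ℕ, ¬ (c ≤ j ∧ j < c) := fun c h => absurd h.1 (not_le.2 h.2)
  have hP2 : ∀ c : ℕ, ¬ (j < c ∧ c ≤ j) := fun c h => absurd h.2 (not_le.2 h.1)
  rw [exchange_eq_deleted w A o q hqo E (fun c => c ≤ j) (fun c => j < c) hP1,
    exchange_eq_deleted w A o q hqo E (fun c => j < c) (fun c => c ≤ j) hP2]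
  have ht0 : 0 ≤ 1 - (w s(o, q) : ℝ) := sub_nonneg.2 (unitInterval.le_one _)
  by_cases ht : ((w s(o, q) : unitInterval) : ℝ) < 1
  · have hbeat₀ : ∀ x ∈ Q, (prodBernoulli (Function.update w s(o, q) 0)).real
          {ω : BondConfig (Fin n) | (A.filter fun r => ω ∈ openConn x r).card ≤ j} ≤
        (prodBernoulli (Function.update w s(o, q) 0)).real
          {ω : BondConfig (Fin n) | (A.filter fun r => ω ∈ openConn q r).card ≤ j} :=
      fun x hx => ExchangeTools.forwardGreedy_step w A o q x j hqo ht (hbeat x hx)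
    exact mul_le_mul_of_nonneg_left (hREX₀ hbeat₀) ht0
  · have h1 : ((w s(o, q) : unitInterval) : ℝ) = 1 := le_antisymm (unitInterval.le_one _) (not_lt.1 ht)
    rw [h1]; simp

/-- **REX(2) for an observer adjacent only to `a`, `b` and `q`.**  If `o ∉ A` has positive-weight pairs only to `a`, `b`, `q`
(`a ≠ b`; `a, b, q ≠ o`) and `q` beats `a` and `b` at level `j`, then
`μ(({o↔a} ∪ {o↔b}) ∩ L_o ∩ H_q) ≤ μ(({o↔a} ∪ {o↔b}) ∩ H_o ∩ L_q)`.
Proof: `rex_of_deleted` + `TwoPortExchange.twoPort_rex` in `w[s(o,q) ↦ 0]`, where `o` is a two-port observer. [this work] -/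
theorem threePort_rex (w : Sym2 (Fin n) → unitInterval) (A : Finset (Fin n)) (o a b q : Fin n) (j : ℕ)
    (ho : o ∉ A) (hao : a ≠ o) (hbo : b ≠ o) (hqo : q ≠ o) (hab : a ≠ b)
    (hport : ∀ v, v ≠ o → v ≠ a → v ≠ b → v ≠ q → w s(o, v) = 0)
    (hSa : (prodBernoulli w).real {ω : BondConfig (Fin n) | (A.filter fun r => ω ∈ openConn a r).card ≤ j} ≤
      (prodBernoulli w).real {ω : BondConfig (Fin n) | (A.filter fun r => ω ∈ openConn q r).card ≤ j})
    (hSb : (prodBernoulli w).real {ω : BondConfig (Fin n) | (A.filter fun r => ω ∈ openConn b r).card ≤ j} ≤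
      (prodBernoulli w).real {ω : BondConfig (Fin n) | (A.filter fun r => ω ∈ openConn q r).card ≤ j}) :
    (prodBernoulli w).real ((((openConn o a : Set (BondConfig (Fin n))) ∪ (openConn o b : Set (BondConfig (Fin n)))) ∩
        {ω | (A.filter fun r => ω ∈ openConn o r).card ≤ j}) ∩ {ω | j < (A.filter fun r => ω ∈ openConn q r).card}) ≤
      (prodBernoulli w).real ((((openConn o a : Set (BondConfig (Fin n))) ∪ (openConn o b : Set (BondConfig (Fin n)))) ∩
        {ω | j < (A.filter fun r => ω ∈ openConn o r).card}) ∩ {ω | (A.filter fun r => ω ∈ openConn q r).card ≤ j}) := by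
  set E : Set (BondConfig (Fin n)) := (openConn o a : Set (BondConfig (Fin n))) ∪ (openConn o b : Set (BondConfig (Fin n)))
    with hE
  have key := rex_of_deleted w A ({a, b} : Finset (Fin n)) o q j hqo E ?_ ?_
  · exact key
  · -- REX in the deleted weights: `o` is a two-port observer there
    intro hbeat₀
    set w₀ := Function.update w s(o, q) 0 with hw₀
    have hport₀ : ∀ v, v ≠ o → v ≠ a → v ≠ b → w₀ s(o, v) = 0 := by
      intro v hvo hva hvb
      by_cases hvq : v = q
      · subst hvq; rw [hw₀, Function.update_self]
      · have hne : s(o, v) ≠ s(o, q) := by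
          intro h
          rcases Sym2.eq_iff.1 h with ⟨-, h2⟩ | ⟨h1, -⟩
          · exact hvq h2
          · exact hqo h1.symm
        rw [hw₀, Function.update_of_ne hne]
        exact hport v hvo hva hvb hvq
    exact TwoPortExchange.twoPort_rex w₀ A o a b q j ho hao hbo hqo hab hport₀
      (hbeat₀ a (by simp)) (hbeat₀ b (by simp))
  · intro x hx
    rcases Finset.mem_insert.1 hx with rfl | hx'
    · exact hSa
    · rw [Finset.mem_singleton] at hx'; subst hx'; exact hSb

end ObserverPairDeletion

end Summit.CriticalPhenomena.PercolationContinuityZ3.Theorems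

end
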